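import Summits.Ventures.PercRepro.ProfilePointedCircuitClassesStarSharpPencilA

/-!
# PercRepro — THE PENCIL OF CASE D0, PART B: THE ON LINE THROUGH `e` AND A POINT `ℓ` OF `X` — FIRST FACTS
(p5, gen 55; `proofs/P5-GM1.md` §82 ADD 10)

The open sub-case of the pencil: `b` generic, `ρ{e, ℓ, b, b′} = 3` for a point `ℓ ∈ X`.  A set `S ∋ e` is ON iff
`ℓ ∈ cl(S)` (`on_iff_of_line_el`, the lemma of part A with `f := ℓ`), and a bad demand without `c1` is a defect of `R`
(`pencilX_no_swap_of_not_c1`: if its swap were bi-independent, `e, ℓ ∈ cl(π + f)` would make the swap ON).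
-/

open scoped Matroid

namespace PercRepro.Cogirth

open Finset ThmH Skew Shadow Profile

open Classical

variable {α : Type} [DecidableEq α] {N : Matroid α} [N.Finite]

section StarSharpPencilB

variable {b b' : α}

/-- **THE LINE `eℓ` IS ON**: a set `S ∋ e` is ON iff `ℓ ∈ cl(S)`. -/
theorem on_iff_of_line_el (h : SeriesPair N b b') {e f : α} (he : e ∈ gr N)
    (he1 : ∀ y ∈ ((((gr N).erase b).erase b').erase f).erase e, rk N {e, y} = 2) (heb3 : rk N {e, b, b'} = 3)
    {l : α} (hlX : l ∈ ((((gr N).erase b).erase b').erase f).erase e) (hlon : rk N (insert b (insert b' {e, l})) = 3)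
    {S : Finset α} (hS : S ⊆ ((gr N).erase b).erase b') (heS : e ∈ S) :
    rk N (insert b (insert b' S)) = rk N S + 1 ↔ rk N (insert l S) = rk N S := by
  have hXE : ((((gr N).erase b).erase b').erase f).erase e ⊆ ((gr N).erase b).erase b' :=
    (erase_subset _ _).trans (erase_subset _ _)
  have hlE := hXE hlX
  exact on_iff_of_line_ef h he ((erase_subset _ _) ((erase_subset _ _) hlE)) (mem_erase.1 (mem_erase.1 hlE).2).1
    (mem_erase.1 hlE).1 hlon (he1 l hlX) heb3 hS heS

/-- In the pencil through `ℓ ∈ X`: a bad demand without `c1` has no swap in `R` (it is a defect of `R`). -/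
theorem pencilX_no_swap_of_not_c1 (hn : (gr N).card = 9) (h : SeriesPair N b b') {e f : α} (he : e ∈ gr N)
    (hf : f ∈ gr N) (hef : e ≠ f) (heb : e ≠ b) (hfb : f ≠ b) (hfb' : f ≠ b')
    (he1 : ∀ y ∈ ((((gr N).erase b).erase b').erase f).erase e, rk N {e, y} = 2) (heb3 : rk N {e, b, b'} = 3)
    {l : α} (hlX : l ∈ ((((gr N).erase b).erase b').erase f).erase e) (hlon : rk N (insert b (insert b' {e, l})) = 3)
    {W : Finset α} (hW : W ∈ d0DON N b' e f) (hc0 : ¬ d0c0 N b b' e f W) (hc1 : ¬ d0c1 N b e f W) :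
    ¬ (rk N (insert f ((W.erase b).erase e)) = 3 ∧
      rk N (insert e (((((gr N).erase b).erase b').erase f).erase e \ (W.erase b).erase e)) = 4) := by
  rintro ⟨hswap1, hswap2⟩
  have hXE : ((((gr N).erase b).erase b').erase f).erase e ⊆ ((gr N).erase b).erase b' :=
    (erase_subset _ _).trans (erase_subset _ _)
  have hXg : ((((gr N).erase b).erase b').erase f).erase e ⊆ gr N :=
    hXE.trans ((erase_subset _ _).trans (erase_subset _ _))
  have hfE : f ∈ ((gr N).erase b).erase b' := mem_erase.2 ⟨hfb', mem_erase.2 ⟨hfb, hf⟩⟩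
  have heE : e ∈ ((gr N).erase b).erase b' := by
    have hWd := hW
    simp only [d0DON, mem_filter] at hWd
    obtain ⟨hbW, hπX, -⟩ := d0_demand_data h hn hf hef heb hfb hfb' (e := e) W hWd.1 hWd.2.1 hWd.2.2
    have heW := hWd.2.1.1.1
    have heb' : e ≠ b' := fun h' => hWd.2.1.2 (h' ▸ heW)
    exact mem_erase.2 ⟨heb', mem_erase.2 ⟨heb, he⟩⟩
  have hWd := hW
  simp only [d0DON, mem_filter] at hWd
  obtain ⟨-, hπX, -, -, -, hπe, -, hon⟩ := d0_demand_data h hn hf hef heb hfb hfb' (e := e) W hWd.1 hWd.2.1 hWd.2.2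
  -- `ℓ ∈ cl(π + e)` (ON) and `e ∈ cl(π + f)` (`¬c1`): the swap contains `e, ℓ` in its closure, hence is ON
  have hlπe : rk N (insert l (insert e ((W.erase b).erase e))) = rk N (insert e ((W.erase b).erase e)) :=
    (on_iff_of_line_el h he he1 heb3 hlX hlon (insert_subset heE (hπX.trans hXE)) (mem_insert_self _ _)).1
      (by rw [hπe]; exact hon)
  unfold d0c1 at hc1
  have h1 := rk_insert_le_add_one (N := N) he (X := insert f ((W.erase b).erase e)) (insert_subset hf (hπX.trans hXg))
  have h2 : rk N (insert f ((W.erase b).erase e)) ≤ rk N (insert e (insert f ((W.erase b).erase e))) :=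
    rk_mono' (subset_insert _ _)
  rw [insert_f_insert_e_comm] at hc1
  rw [hswap1] at h1 h2
  have h3 : rk N (insert e (insert f ((W.erase b).erase e))) = 3 := by omega
  -- `ℓ ∈ cl(π + e + f)`
  have h4 := rk_insert_eq_of_rk_insert_eq_subset' (N := N) (S := insert e ((W.erase b).erase e))
    (S' := insert e (insert f ((W.erase b).erase e))) (w := l) (insert_subset_insert _ (subset_insert _ _)) hlπe
  rw [h3] at h4
  have hswon := on_of_on_subset_cl h (insert_subset hfE (hπX.trans hXE)) (S₀ := {e, l})
    (by rw [hlon, he1 l hlX]) (by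
      have h5 : rk N (insert f ((W.erase b).erase e)) ≤ rk N (insert f ((W.erase b).erase e) ∪ {e, l}) :=
        rk_mono' subset_union_left
      have h6 : rk N (insert f ((W.erase b).erase e) ∪ {e, l}) ≤
          rk N (insert l (insert e (insert f ((W.erase b).erase e)))) := by
        apply rk_mono'
        intro u hu
        simp only [mem_union, mem_insert, mem_singleton] at hu
        rcases hu with (rfl | hu) | rfl | rfl
        · exact mem_insert_of_mem (mem_insert_of_mem (mem_insert_self _ _))
        · exact mem_insert_of_mem (mem_insert_of_mem (mem_insert_of_mem hu))
        · exact mem_insert_of_mem (mem_insert_self _ _)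
        · exact mem_insert_self _ _
      rw [h4] at h6
      rw [hswap1] at h5 ⊢
      omega)
  rw [hswap1] at hswon
  exact hc0 ⟨hswap1, hswap2, hswon⟩

/-- In the pencil through `ℓ ∈ X` with `b` generic: a demand whose complement `X − π` is ON and has `e` off its
closure contains `ℓ` (else `b` would lie on the line `eℓ` and in the plane `cl(X − π)`, which meet in `ℓ` alone). -/
theorem pencilX_mem_of_swap (hn : (gr N).card = 9) (hR : rk N (gr N) = 5) (h : SeriesPair N b b') {e f : α}
    (he : e ∈ gr N) (hf : f ∈ gr N) (hef : e ≠ f) (heb : e ≠ b) (heb' : e ≠ b') (hfb : f ≠ b) (hfb' : f ≠ b')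
    (hbg : ∀ y ∈ ((((gr N).erase b).erase b').erase f).erase e, rk N {y, b, b'} = 3)
    {l : α} (hlX : l ∈ ((((gr N).erase b).erase b').erase f).erase e) (hlon : rk N (insert b (insert b' {e, l})) = 3)
    {W : Finset α} (hW : W ∈ d0DON N b' e f) (hc2 : ¬ d0c2 N b b' e f W)
    (hswap2 : rk N (insert e (((((gr N).erase b).erase b').erase f).erase e \ (W.erase b).erase e)) = 4) :
    l ∈ (W.erase b).erase e := by
  by_contra hlπ
  have hXE : ((((gr N).erase b).erase b').erase f).erase e ⊆ ((gr N).erase b).erase b' :=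
    (erase_subset _ _).trans (erase_subset _ _)
  have hXg : ((((gr N).erase b).erase b').erase f).erase e ⊆ gr N :=
    hXE.trans ((erase_subset _ _).trans (erase_subset _ _))
  have hWd := hW
  simp only [d0DON, mem_filter] at hWd
  obtain ⟨-, hπX, hπ2, -, -, -, hYf, -⟩ := d0_demand_data h hn hf hef heb hfb hfb' (e := e) W hWd.1 hWd.2.1 hWd.2.2
  have hτ3 := d0_S3 h hn he hf hef heb heb' hfb hfb' _ hπX hπ2 hYf
  have hτE : ((((gr N).erase b).erase b').erase f).erase e \ (W.erase b).erase e ⊆ ((gr N).erase b).erase b' :=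
    sdiff_subset.trans hXE
  have hlτ : l ∈ ((((gr N).erase b).erase b').erase f).erase e \ (W.erase b).erase e := mem_sdiff.2 ⟨hlX, hlπ⟩
  -- the complement is ON: `ρ((X − π) + b + b′) = 4`
  unfold d0c2 at hc2
  have h1 := rk_insert_bb'_bounds h hτE
  rw [hτ3] at h1
  have hτon : rk N (insert b (insert b' (((((gr N).erase b).erase b').erase f).erase e \ (W.erase b).erase e))) = 4 := by
    omega
  -- `(X − π) + e + b + b′` has rank `5`
  have h2 := rk_insert_bb'_bounds h (insert_subset (mem_erase.2 ⟨heb', mem_erase.2 ⟨heb, he⟩⟩) hτE)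
  rw [hswap2] at h2
  have h3 : rk N (insert b (insert b' (insert e (((((gr N).erase b).erase b').erase f).erase e \ (W.erase b).erase e)))) ≤
      rk N (gr N) := rk_mono' (insert_subset h.1 (insert_subset h.2.1 (insert_subset he (sdiff_subset.trans hXg))))
  rw [hR] at h3
  -- submodularity: the line `eℓ + b + b′` and the plane `(X − π) + b + b′` meet in `{ℓ, b, b′}` of rank `3`
  have h4 := rk_union_add_rk_le_of_subset_inter' (N := N)
    (S := insert b (insert b' (((((gr N).erase b).erase b').erase f).erase e \ (W.erase b).erase e)))
    (T := insert b (insert b' {e, l})) (I := {l, b, b'}) (by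
      intro u hu; simp only [mem_insert, mem_singleton] at hu
      rcases hu with rfl | rfl | rfl
      · exact mem_inter.2 ⟨mem_insert_of_mem (mem_insert_of_mem hlτ),
          mem_insert_of_mem (mem_insert_of_mem (mem_insert_of_mem (mem_singleton_self _)))⟩
      · exact mem_inter.2 ⟨mem_insert_self _ _, mem_insert_self _ _⟩
      · exact mem_inter.2 ⟨mem_insert_of_mem (mem_insert_self _ _), mem_insert_of_mem (mem_insert_self _ _)⟩)
  have h5 : rk N (insert b (insert b' (insert e (((((gr N).erase b).erase b').erase f).erase e \ (W.erase b).erase e)))) ≤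
      rk N (insert b (insert b' (((((gr N).erase b).erase b').erase f).erase e \ (W.erase b).erase e)) ∪
        insert b (insert b' {e, l})) := by
    apply rk_mono'
    intro u hu
    rw [mem_insert, mem_insert, mem_insert] at hu
    rcases hu with rfl | rfl | rfl | hu
    · exact mem_union_left _ (mem_insert_self _ _)
    · exact mem_union_left _ (mem_insert_of_mem (mem_insert_self _ _))
    · exact mem_union_right _ (mem_insert_of_mem (mem_insert_of_mem (mem_insert_self _ _)))
    · exact mem_union_left _ (mem_insert_of_mem (mem_insert_of_mem hu))
  rw [hτon, hlon, hbg l hlX] at h4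
  omega

/-- In the pencil through `ℓ ∈ X` with `b` generic: for a bad demand `{ℓ, t}` whose swap is bi-independent, the other
endpoint `t` is a C-point (`ρ{e, f, t} = 3` by `c1`, and `ρ(X − t) = 4` because `ℓ ∈ cl(X − π)` would again put `b`
on the line `eℓ` and in the plane `cl(X − π)`). -/
theorem pencilX_cpoint_of_swap (hn : (gr N).card = 9) (hR : rk N (gr N) = 5) (h : SeriesPair N b b') {e f : α}
    (he : e ∈ gr N) (hf : f ∈ gr N) (hef : e ≠ f) (heb : e ≠ b) (heb' : e ≠ b') (hfb : f ≠ b) (hfb' : f ≠ b')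
    (hf1 : ∀ y ∈ ((((gr N).erase b).erase b').erase f).erase e, rk N {f, y} = 2)
    (hbg : ∀ y ∈ ((((gr N).erase b).erase b').erase f).erase e, rk N {y, b, b'} = 3)
    {l : α} (hlX : l ∈ ((((gr N).erase b).erase b').erase f).erase e) (hlon : rk N (insert b (insert b' {e, l})) = 3)
    {W : Finset α} (hW : W ∈ d0DON N b' e f) (hc1 : d0c1 N b e f W) (hc2 : ¬ d0c2 N b b' e f W)
    (hswap2 : rk N (insert e (((((gr N).erase b).erase b').erase f).erase e \ (W.erase b).erase e)) = 4)
    {t : α} (ht : t ∈ (W.erase b).erase e) (htl : t ≠ l) :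
    rk N {e, f, t} = 3 ∧ rk N ((((((gr N).erase b).erase b').erase f).erase e).erase t) = 4 := by
  have hXE : ((((gr N).erase b).erase b').erase f).erase e ⊆ ((gr N).erase b).erase b' :=
    (erase_subset _ _).trans (erase_subset _ _)
  have hXg : ((((gr N).erase b).erase b').erase f).erase e ⊆ gr N :=
    hXE.trans ((erase_subset _ _).trans (erase_subset _ _))
  have hWd := hW
  simp only [d0DON, mem_filter] at hWd
  obtain ⟨-, hπX, hπ2, -, -, -, hYf, -⟩ := d0_demand_data h hn hf hef heb hfb hfb' (e := e) W hWd.1 hWd.2.1 hWd.2.2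
  have hlπ := pencilX_mem_of_swap hn hR h he hf hef heb heb' hfb hfb' hbg hlX hlon hW hc2 hswap2
  have hπeq : (W.erase b).erase e = {l, t} := eq_pair_of_card_two hπ2 hlπ ht htl.symm
  have htX := hπX ht
  have hτ3 := d0_S3 h hn he hf hef heb heb' hfb hfb' _ hπX hπ2 hYf
  have hτE : ((((gr N).erase b).erase b').erase f).erase e \ (W.erase b).erase e ⊆ ((gr N).erase b).erase b' :=
    sdiff_subset.trans hXE
  constructor
  · -- `t` off the line `ef`: else `e ∈ cl(π + f)`, against `c1`
    by_contra hne
    have h1 : rk N (insert e {f, t}) ≤ 3 := by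
      have := rk_insert_le_add_one (N := N) he (X := {f, t}) (insert_subset hf (singleton_subset_iff.2 (hXg htX)))
      rw [hf1 t htX] at this
      exact this
    have h2 : rk N {f, t} ≤ rk N (insert e {f, t}) := rk_mono' (subset_insert _ _)
    rw [hf1 t htX] at h2
    rw [← triple_eq_insert_last, triple_rot'] at h1 h2 hne
    have h3 : rk N (insert e {f, t}) = rk N {f, t} := by rw [hf1 t htX, ← triple_eq_insert_last, triple_rot']; omega
    have h4 := rk_insert_eq_of_rk_insert_eq_subset' (N := N) (S := {f, t}) (S' := insert f ((W.erase b).erase e)) (w := e)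
      (by
        intro u hu; simp only [mem_insert, mem_singleton] at hu
        rcases hu with rfl | rfl
        · exact mem_insert_self _ _
        · exact mem_insert_of_mem ht) h3
    unfold d0c1 at hc1
    rw [insert_f_insert_e_comm, h4] at hc1
    have h5 := rk_le_card' (M := N) (insert f ((W.erase b).erase e))
    have h6 := card_insert_le f ((W.erase b).erase e)
    omega
  · -- `ρ(X − t) = 4`: `X − t = (X − π) + ℓ`; if `ℓ ∈ cl(X − π)` then `(X − π) + ℓ` is ON of rank 3 and meets the line
    by_contra hne
    have hXt : (((((gr N).erase b).erase b').erase f).erase e).erase t =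
        insert l (((((gr N).erase b).erase b').erase f).erase e \ (W.erase b).erase e) := by
      ext a
      rw [mem_erase, mem_insert, mem_sdiff, hπeq, mem_insert, mem_singleton]
      constructor
      · rintro ⟨hat, haX⟩
        by_cases hal : a = l
        · exact Or.inl hal
        · exact Or.inr ⟨haX, by push Not; exact ⟨hal, hat⟩⟩
      · rintro (rfl | ⟨haX, hna⟩)
        · exact ⟨htl.symm, hlX⟩
        · push Not at hna; exact ⟨hna.2, haX⟩
    rw [hXt] at hne
    have h1 : rk N (insert l (((((gr N).erase b).erase b').erase f).erase e \ (W.erase b).erase e)) = 3 := by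
      have h2 := rk_insert_le_add_one (N := N) (hXg hlX)
        (X := ((((gr N).erase b).erase b').erase f).erase e \ (W.erase b).erase e) (sdiff_subset.trans hXg)
      have h3 : rk N (((((gr N).erase b).erase b').erase f).erase e \ (W.erase b).erase e) ≤
          rk N (insert l (((((gr N).erase b).erase b').erase f).erase e \ (W.erase b).erase e)) :=
        rk_mono' (subset_insert _ _)
      omega
    -- the complement is ON, hence so is `(X − π) + ℓ` (same closure)
    unfold d0c2 at hc2
    have h4 := rk_insert_bb'_bounds h hτE
    rw [hτ3] at h4
    have hτon : rk N (insert b (insert b' (((((gr N).erase b).erase b').erase f).erase e \ (W.erase b).erase e))) = 4 := by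
      omega
    have hlon' : rk N (insert b (insert b' (insert l (((((gr N).erase b).erase b').erase f).erase e \ (W.erase b).erase e)))) = 4 := by
      have h5 := rk_insert_eq_of_rk_insert_eq_subset' (N := N)
        (S := ((((gr N).erase b).erase b').erase f).erase e \ (W.erase b).erase e)
        (S' := insert b (insert b' (((((gr N).erase b).erase b').erase f).erase e \ (W.erase b).erase e))) (w := l)
        ((subset_insert _ _).trans (subset_insert _ _)) (by rw [h1, hτ3])
      have h6 : insert l (insert b (insert b' (((((gr N).erase b).erase b').erase f).erase e \ (W.erase b).erase e))) =
          insert b (insert b' (insert l (((((gr N).erase b).erase b').erase f).erase e \ (W.erase b).erase e))) := by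
        rw [insert_comm l b, insert_comm l b']
      rw [h6, hτon] at h5
      exact h5
    -- `(X − π) + e + b + b′` has rank 5
    have h7 := rk_insert_bb'_bounds h (insert_subset (mem_erase.2 ⟨heb', mem_erase.2 ⟨heb, he⟩⟩) hτE)
    rw [hswap2] at h7
    have h8 : rk N (insert b (insert b' (insert e (((((gr N).erase b).erase b').erase f).erase e \ (W.erase b).erase e)))) ≤
        rk N (gr N) := rk_mono' (insert_subset h.1 (insert_subset h.2.1 (insert_subset he (sdiff_subset.trans hXg))))
    rw [hR] at h8
    have h9 := rk_union_add_rk_le_of_subset_inter' (N := N)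
      (S := insert b (insert b' (insert l (((((gr N).erase b).erase b').erase f).erase e \ (W.erase b).erase e))))
      (T := insert b (insert b' {e, l})) (I := {l, b, b'}) (by
        intro u hu; simp only [mem_insert, mem_singleton] at hu
        rcases hu with rfl | rfl | rfl
        · exact mem_inter.2 ⟨mem_insert_of_mem (mem_insert_of_mem (mem_insert_self _ _)),
            mem_insert_of_mem (mem_insert_of_mem (mem_insert_of_mem (mem_singleton_self _)))⟩
        · exact mem_inter.2 ⟨mem_insert_self _ _, mem_insert_self _ _⟩
        · exact mem_inter.2 ⟨mem_insert_of_mem (mem_insert_self _ _), mem_insert_of_mem (mem_insert_self _ _)⟩)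
    have h10 : rk N (insert b (insert b' (insert e (((((gr N).erase b).erase b').erase f).erase e \ (W.erase b).erase e)))) ≤
        rk N (insert b (insert b' (insert l (((((gr N).erase b).erase b').erase f).erase e \ (W.erase b).erase e))) ∪
          insert b (insert b' {e, l})) := by
      apply rk_mono'
      intro u hu
      rw [mem_insert, mem_insert, mem_insert] at hu
      rcases hu with rfl | rfl | rfl | hu
      · exact mem_union_left _ (mem_insert_self _ _)
      · exact mem_union_left _ (mem_insert_of_mem (mem_insert_self _ _))
      · exact mem_union_right _ (mem_insert_of_mem (mem_insert_of_mem (mem_insert_self _ _)))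
      · exact mem_union_left _ (mem_insert_of_mem (mem_insert_of_mem (mem_insert_of_mem hu)))
    rw [hlon', hlon, hbg l hlX] at h9
    omega

/-- In the pencil through `ℓ ∈ X`: a demand with `e ∈ cl(X − π)` and ON complement does not contain `ℓ` (`ℓ` would
lie in `cl((X − π) + b + b′)`, making `(X − π) + ℓ + b + b′` of rank 4 although `(X − π) + ℓ = X − t` has rank 4). -/
theorem pencilX_not_mem_of_B1 (hn : (gr N).card = 9) (h : SeriesPair N b b') {e f : α} (he : e ∈ gr N)
    (hf : f ∈ gr N) (hef : e ≠ f) (heb : e ≠ b) (heb' : e ≠ b') (hfb : f ≠ b) (hfb' : f ≠ b')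
    (hfc : ∀ y ∈ ((((gr N).erase b).erase b').erase f).erase e, rk N (((((gr N).erase b).erase b').erase f).erase y) = 4)
    (heb3 : rk N {e, b, b'} = 3)
    {l : α} (hlX : l ∈ ((((gr N).erase b).erase b').erase f).erase e) (hlon : rk N (insert b (insert b' {e, l})) = 3)
    {W : Finset α} (hW : W ∈ d0DON N b' e f) (hc2 : ¬ d0c2 N b b' e f W)
    (hB1 : rk N (insert e (((((gr N).erase b).erase b').erase f).erase e \ (W.erase b).erase e)) = 3) :
    l ∉ (W.erase b).erase e := by
  intro hlπ
  have hXE : ((((gr N).erase b).erase b').erase f).erase e ⊆ ((gr N).erase b).erase b' :=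
    (erase_subset _ _).trans (erase_subset _ _)
  have hXg : ((((gr N).erase b).erase b').erase f).erase e ⊆ gr N :=
    hXE.trans ((erase_subset _ _).trans (erase_subset _ _))
  have hWd := hW
  simp only [d0DON, mem_filter] at hWd
  obtain ⟨-, hπX, hπ2, -, -, -, hYf, -⟩ := d0_demand_data h hn hf hef heb hfb hfb' (e := e) W hWd.1 hWd.2.1 hWd.2.2
  obtain ⟨t, htπ, htl⟩ := exists_mem_ne (by omega : 1 < ((W.erase b).erase e).card) l
  have hπeq : (W.erase b).erase e = {l, t} := eq_pair_of_card_two hπ2 hlπ htπ htl.symm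
  have htX := hπX htπ
  have hτ3 := d0_S3 h hn he hf hef heb heb' hfb hfb' _ hπX hπ2 hYf
  have hτE : ((((gr N).erase b).erase b').erase f).erase e \ (W.erase b).erase e ⊆ ((gr N).erase b).erase b' :=
    sdiff_subset.trans hXE
  -- the complement is ON
  unfold d0c2 at hc2
  have h1 := rk_insert_bb'_bounds h hτE
  rw [hτ3] at h1
  have hτon : rk N (insert b (insert b' (((((gr N).erase b).erase b').erase f).erase e \ (W.erase b).erase e))) = 4 := by
    omega
  -- `e ∈ cl((X − π) + b + b′)`, `ℓ ∈ cl{e, b, b′}`: so `ℓ ∈ cl((X − π) + b + b′)`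
  have h2 := rk_insert_eq_of_rk_insert_eq_subset' (N := N)
    (S := ((((gr N).erase b).erase b').erase f).erase e \ (W.erase b).erase e)
    (S' := insert b (insert b' (((((gr N).erase b).erase b').erase f).erase e \ (W.erase b).erase e))) (w := e)
    ((subset_insert _ _).trans (subset_insert _ _)) (by rw [hB1, hτ3])
  have h3 : rk N (insert l {e, b, b'}) = rk N {e, b, b'} := by
    have h4 : insert l ({e, b, b'} : Finset α) = insert b (insert b' {e, l}) := by
      ext u; simp only [mem_insert, mem_singleton]; tauto
    rw [h4, hlon, heb3]
  have h5 := rk_insert_eq_of_rk_insert_eq_subset' (N := N) (S := {e, b, b'})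
    (S' := insert e (insert b (insert b' (((((gr N).erase b).erase b').erase f).erase e \ (W.erase b).erase e))))
    (w := l) (by
      intro u hu; simp only [mem_insert, mem_singleton] at hu
      rcases hu with rfl | rfl | rfl
      · exact mem_insert_self _ _
      · exact mem_insert_of_mem (mem_insert_self _ _)
      · exact mem_insert_of_mem (mem_insert_of_mem (mem_insert_self _ _))) h3
  rw [h2, hτon] at h5
  -- but `(X − π) + ℓ = X − t` has rank 4, so adding `b, b′` gives rank `≥ 5`
  have hXt : (((((gr N).erase b).erase b').erase f).erase e).erase t =
      insert l (((((gr N).erase b).erase b').erase f).erase e \ (W.erase b).erase e) := by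
    ext a
    rw [mem_erase, mem_insert, mem_sdiff, hπeq, mem_insert, mem_singleton]
    constructor
    · rintro ⟨hat, haX⟩
      by_cases hal : a = l
      · exact Or.inl hal
      · exact Or.inr ⟨haX, by push Not; exact ⟨hal, hat⟩⟩
    · rintro (rfl | ⟨haX, hna⟩)
      · exact ⟨htl.symm, hlX⟩
      · push Not at hna; exact ⟨hna.2, haX⟩
  have h6 := hfc t htX
  rw [← insert_e_X_erase_eq he hef heb heb' htX, hXt] at h6
  have h7 : rk N (insert e (insert l (((((gr N).erase b).erase b').erase f).erase e \ (W.erase b).erase e))) ≤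
      rk N (insert l (insert e (insert b (insert b' (((((gr N).erase b).erase b').erase f).erase e \ (W.erase b).erase e))))) := by
    apply rk_mono'
    intro u hu
    rw [mem_insert, mem_insert] at hu
    rcases hu with rfl | rfl | hu
    · exact mem_insert_of_mem (mem_insert_self _ _)
    · exact mem_insert_self _ _
    · exact mem_insert_of_mem (mem_insert_of_mem (mem_insert_of_mem (mem_insert_of_mem hu)))
  rw [h5] at h7
  -- `(X − π) + ℓ + e + b + b′` has rank `≥ ρ((X − π) + ℓ + e) + 1`: with `e ∈ cl(X − π)` this is `≥ 5`
  have h8 : rk N (insert e (insert l (((((gr N).erase b).erase b').erase f).erase e \ (W.erase b).erase e))) = 4 := h6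
  have h9 := rk_insert_bb'_bounds h (insert_subset (mem_erase.2 ⟨heb', mem_erase.2 ⟨heb, he⟩⟩)
    (insert_subset (hXE hlX) hτE))
  have h10 : rk N (insert b (insert b' (insert e (insert l (((((gr N).erase b).erase b').erase f).erase e \ (W.erase b).erase e))))) ≤
      rk N (insert l (insert e (insert b (insert b' (((((gr N).erase b).erase b').erase f).erase e \ (W.erase b).erase e))))) := by
    apply rk_mono'
    intro u hu
    rw [mem_insert, mem_insert, mem_insert, mem_insert] at hu
    rcases hu with rfl | rfl | rfl | rfl | hu
    · exact mem_insert_of_mem (mem_insert_of_mem (mem_insert_self _ _))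
    · exact mem_insert_of_mem (mem_insert_of_mem (mem_insert_of_mem (mem_insert_self _ _)))
    · exact mem_insert_of_mem (mem_insert_self _ _)
    · exact mem_insert_self _ _
    · exact mem_insert_of_mem (mem_insert_of_mem (mem_insert_of_mem (mem_insert_of_mem hu)))
  rw [h5] at h10
  rw [h8] at h9
  omega

/-- In the pencil through `ℓ ∈ X`: a bad demand with `c1` that is a defect of `R` (no swap) does not contain `ℓ`. -/
theorem pencilX_not_mem_of_c1_defect (hn : (gr N).card = 9) (h : SeriesPair N b b') {e f : α} (he : e ∈ gr N)
    (hf : f ∈ gr N) (hef : e ≠ f) (heb : e ≠ b) (heb' : e ≠ b') (hfb : f ≠ b) (hfb' : f ≠ b')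
    (hfc : ∀ y ∈ ((((gr N).erase b).erase b').erase f).erase e, rk N (((((gr N).erase b).erase b').erase f).erase y) = 4)
    (heb3 : rk N {e, b, b'} = 3)
    {l : α} (hlX : l ∈ ((((gr N).erase b).erase b').erase f).erase e) (hlon : rk N (insert b (insert b' {e, l})) = 3)
    {W : Finset α} (hW : W ∈ d0DON N b' e f) (hc1 : d0c1 N b e f W) (hc2 : ¬ d0c2 N b b' e f W)
    (hres : ¬ (rk N (insert f ((W.erase b).erase e)) = 3 ∧
      rk N (insert e (((((gr N).erase b).erase b').erase f).erase e \ (W.erase b).erase e)) = 4)) :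
    l ∉ (W.erase b).erase e := by
  have hXg : ((((gr N).erase b).erase b').erase f).erase e ⊆ gr N :=
    (erase_subset _ _).trans ((erase_subset _ _).trans ((erase_subset _ _).trans (erase_subset _ _)))
  have hWd := hW
  simp only [d0DON, mem_filter] at hWd
  obtain ⟨-, hπX, hπ2, -, -, -, hYf, -⟩ := d0_demand_data h hn hf hef heb hfb hfb' (e := e) W hWd.1 hWd.2.1 hWd.2.2
  -- `c1` forces `ρ(π + f) = 3`, so the missing swap is `e ∈ cl(X − π)`
  unfold d0c1 at hc1
  have h1 := rk_insert_le_add_one (N := N) he (X := insert f ((W.erase b).erase e)) (insert_subset hf (hπX.trans hXg))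
  have h2 := rk_le_card' (M := N) (insert f ((W.erase b).erase e))
  have h3 := card_insert_le f ((W.erase b).erase e)
  rw [insert_f_insert_e_comm] at hc1
  have hπf : rk N (insert f ((W.erase b).erase e)) = 3 := by omega
  have hτ3 := d0_S3 h hn he hf hef heb heb' hfb hfb' _ hπX hπ2 hYf
  have h4 := rk_insert_le_add_one (N := N) he (X := ((((gr N).erase b).erase b').erase f).erase e \ (W.erase b).erase e)
    (sdiff_subset.trans hXg)
  have h5 : rk N (((((gr N).erase b).erase b').erase f).erase e \ (W.erase b).erase e) ≤
      rk N (insert e (((((gr N).erase b).erase b').erase f).erase e \ (W.erase b).erase e)) :=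
    rk_mono' (subset_insert _ _)
  have hB1 : rk N (insert e (((((gr N).erase b).erase b').erase f).erase e \ (W.erase b).erase e)) = 3 := by
    by_contra hne
    exact hres ⟨hπf, by omega⟩
  exact pencilX_not_mem_of_B1 hn h he hf hef heb heb' hfb hfb' hfc heb3 hlX hlon hW hc2 hB1

end StarSharpPencilB

end PercRepro.Cogirth
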